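import Summits.QuantumFields.YangMills.Theorems.UnitScaleTiltFluctuationComparisonRegPrGlobalSlackLegCfgDistNaturalT3Gamma
import HarnessLib

/-!
# `UnitScaleTiltFluctuationComparisonRegPrGlobalSlackLegCfgDistNaturalT3Door` — THE DOOR DISPLAY `K1aLegRowsDisplayChiAtLow` FOR THE NATURAL CONFIGURATION FAMILY `B♮`: (R4-low) and the
# configuration clause of (N) are THEOREMS (✓`cfgDistOwnΦLow_chi_natural`, ✓`natural_newLevel_eq_bcfg`), so the display at `p₁ ≥ p₀ + r₀` follows from its FOUR remaining rows (R1), (R2′),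
# (M1), (R5) read at `B := B♮` plus the chart / vacuum-constant clauses of (N) — by name, with the coupling threshold shrunk by `gammaθ b₀ p₁ σ♮` (crux `FluctuationComparisonRegPrIntL`,
# stmt-QuantumFields-20520, skeletons v5kC / v5kD, STUB 3⁗χ; cell `pub/ym-inputs`, seat ym-inputs-p11; count-neutral helper, def-free, registry untouched)

WHY.  `K1aLegRowsDisplayChiAtLow L 𝔠 a₀ a₁ a p₁` (`…KernelLegDisplayProfileLow`, the K1a input of the rung certificate `YM3OfFiveInputsProfile.ym3TorusSU2_of_fiveInputs_displayAt` through
`k1aLegRowsDisplayChiAt_of_low`) asks, per family / coupling below a threshold and per inhabited χ-package, for ONE triple `(Φ, e, B)` with six rows.  For the natural `B♮` of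
`…LegCfgDistNaturalT3` two of them are proved; this file states the REMAINING OBLIGATION in the display's own letters and derives the display from it:
**`k1aLegRowsDisplayChiAtLow_of_naturalRows`** — if, with constants `κ′ ρ C C_A C_B γB`, for every `F` (`F.L = L`), `γ ≤ γB`, there are a height-free reference `Ψ` and a coherent
reference `BR` such that every coherent χ-package `p` admits charts `Φ` and vacuum constants `e` with (R1) `KernelRefOwnΦ … Φ Ψ …`, (R2′) `ChartAnalyticΦ … (rescaleΦw … Φ) …`, the
new-level clauses `Φ = birthChartCore`, `e = 0` on the retained domains, (M1) `OldTermsAreJetsOwn q Φ e B♮` and (R5) `CfgRefOwnΦ … B♮ BR …`, then `K1aLegRowsDisplayChiAtLow L 𝔠 a₀ a₁ a p₁`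
holds with `C_s := 24·L·B₃` and threshold `min γB (gammaθ b₀ p₁ σ♮)`.  Nothing of [Balaban1985UV3] / [King1986] asserted; the four rows stay HYPOTHESES (the (α)-record desk's: (M1) is
the content); no summit / rung / gap claim (YM₃ on T³ is ladder rung R3, not the Clay problem).

References: T. Bałaban, CMP 102 (1985) 255–275 [Balaban1985UV3] ((27)–(28) p.263, (43)–(45) pp.266–267, (60)–(61) p.271); C. King, CMP 102 (1986) 649–677 [King1986] (Thm 3.4 (3.9)
p.656, Prop. 3.6 (3.56) p.662, Prop. 3.9 (3.71)–(3.74) p.665).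
-/

set_option autoImplicit false

noncomputable section

open scoped Matrix.Norms.L2Operator
open Literature.MathematicalPhysics.QuantumFieldTheory.Balaban1983to89
open Literature.MathematicalPhysics.QuantumFieldTheory.Balaban1983to89.T3ContinuumYM3Torus
open Literature.MathematicalPhysics.QuantumFieldTheory.Balaban1983to89.T3UnitLawDensityEML (ℰp)
open Literature.MathematicalPhysics.QuantumFieldTheory.Balaban1983to89.T3UnitScaleTilt (θBal)
open Literature.MathematicalPhysics.QuantumFieldTheory.Balaban1983to89.T3LevelShift (fieldShift)
open Literature.MathematicalPhysics.QuantumFieldTheory.Balaban1983to89.TreeLengthTorus (tsys)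
open Literature.MathematicalPhysics.QuantumFieldTheory.Balaban1983to89.B10Eq27TorusAxialLog
open Literature.MathematicalPhysics.QuantumFieldTheory.Balaban1983to89.B7Prop1Explicit (l1)
open Literature.MathematicalPhysics.QuantumFieldTheory.Balaban1983to89.ExpMeanLog (deltaSU deltaSU_pos)
open Literature.MathematicalPhysics.QuantumFieldTheory.Balaban1985CMP102
open Literature.MathematicalPhysics.QuantumFieldTheory.Balaban1985CMP102.Setting
open Summit.QuantumFields.Balaban3D.Carriers
open Summit.QuantumFields.Balaban3D.Proofs.Primitives
open Summit.QuantumFields.Balaban3D.Proofs.GroupModelLieC (vecE lieC)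
open Summit.QuantumFields.YangMills.Theorems
open Summit.QuantumFields.YangMills.Theorems.GlobalSlackKernelMatching
open Summit.QuantumFields.YangMills.Theorems.GlobalSlackCanonicalPolymers

namespace Summit.QuantumFields.YangMills.Theorems.GlobalSlackKernelLeg

open Classical in
/-- **THE DOOR DISPLAY FROM ITS FOUR REMAINING ROWS AT `B := B♮`**: (R1), (R2′), the new-level chart / vacuum-constant clauses, (M1) and (R5) for the natural configuration family, with
constants `κ′ ρ C C_A C_B` and a threshold `γB`, give `K1aLegRowsDisplayChiAtLow L 𝔠 a₀ a₁ a p₁` for every `p₁ ≥ p₀ + r₀` (constant `C_s = 24·L·B₃`, threshold `min γB (gammaθ b₀ p₁ σ♮)`; (R4-low)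
and (N)'s configuration clause supplied by `cfgDistOwnΦLow_chi_natural`, `windowLetters_of_le_gammaθ`, `natural_newLevel_eq_bcfg`).
[cite: Balaban1985UV3, (27)-(28) p.263, (43)-(45) pp.266-267, (60)-(61) p.271; King1986, Prop. 3.6 (3.56) p.662, Prop. 3.9 (3.71)-(3.74) p.665] -/
theorem k1aLegRowsDisplayChiAtLow_of_naturalRows {L : ℕ} (hL : 1 < L) {𝔠 : AlphaConsts L (suGroupModel 2).N} {a₀ a₁ a p₁ : ℝ} (ha₀ : 0 < a₀) (ha₁ : 0 < a₁)
    (hp₁ : 𝔠.p₀ + 𝔠.r₀ ≤ p₁)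
    (h : ∃ (κ' ρ C C_A C_B γB : ℝ), 0 < κ' ∧ 0 < ρ ∧ 0 ≤ C ∧ 0 ≤ C_A ∧ 0 ≤ C_B ∧ 0 < γB ∧
      ∀ (F : T3Family) (γ : ℝ) (hF : F.L = L) (hγ : 0 < γ), γ ≤ γB → ∀ (hγ1 : γ ≤ (min (hF ▸ 𝔠).gamma0 1) ^ 2),
        ∃ (Ψ : ChartFam ↥(lieC (suGroupModel 2)) F) (BR : CfgFam ↥(lieC (suGroupModel 2)) F), KerHeightFree Ψ ∧ RefCfgCoherent BR ∧
          (AlphaInputsT3AC.OfV3ChiAt F (hF ▸ 𝔠) a₀ a₁ →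
            ∃ (p : ∀ K, AlphaInputsT3AC.PkgAtV3Chi F (hF ▸ 𝔠) γ hγ hγ1 K), (∀ K, (p K).a₀ = a₀ ∧ (p K).a₁ = a₁) ∧
              ∃ (Φ : ChartFam ↥(lieC (suGroupModel 2)) F) (e : VacFam F),
                KernelRefOwnΦ (AlphaInputsT3AC.dataOfV3chi p (canonPolymerCore fun K => (p K).toCore)) Φ Ψ (canonLegDist F) κ' (hF ▸ 𝔠).κ a C ∧
                ChartAnalyticΦ (AlphaInputsT3AC.dataOfV3chi p (canonPolymerCore fun K => (p K).toCore)) (rescaleΦw (canonLegDist F) κ' Φ) (hF ▸ 𝔠).κ ρ C_A ∧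
                (∀ (K k : ℕ), k + 1 ≤ K → ∀ X ∈ newDomsCore (fun K => (p K).toCore) K k (Hist.triv (F.P K) (k + 1)),
                  Φ K k (domSet (F := F) (hF ▸ 𝔠).lane.carrier.M₁ K k X) = birthChartCore (fun K => (p K).toCore) K k (domSet (F := F) (hF ▸ 𝔠).lane.carrier.M₁ K k X) ∧
                  e K k (domSet (F := F) (hF ▸ 𝔠).lane.carrier.M₁ K k X) = 0) ∧
                OldTermsAreJetsOwn (fun K => (p K).toCore) Φ e
                  (fun K k b Y W c =>
                    if h : b + 1 = k then birthCfgAt (fun K => (p K).toCore) K b Y (h ▸ W) c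
                    else if (l1 (rel (anchors_nonempty (F := F) K b Y).choose c.src) : ℝ) *
                        (2 * ((hF ▸ 𝔠).B₃ * θBal F.L γ (hF ▸ 𝔠).b₀ p₁ (K - k)) * (((F.L : ℝ) ^ (k - b))⁻¹) ^ 2) ≤ 1 / 2 then
                      (lieC (suGroupModel 2)).orthogonalProjectionOnto
                        (vecE (suGroupModel 2).N
                          (B27T (unitsField (toUField (Averaging.iter (fun i => BlockAveraging.blockAvg (P := F.P K) (j := i) ℰp) b
                            ((p K).UkH k (Hist.triv (F.P K) k) W)))) (anchors_nonempty (F := F) K b Y).choose c))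
                    else 0) ∧
                CfgRefOwnΦ (AlphaInputsT3AC.dataOfV3chi p (canonPolymerCore fun K => (p K).toCore))
                  (fun K k b Y W c =>
                    if h : b + 1 = k then birthCfgAt (fun K => (p K).toCore) K b Y (h ▸ W) c
                    else if (l1 (rel (anchors_nonempty (F := F) K b Y).choose c.src) : ℝ) *
                        (2 * ((hF ▸ 𝔠).B₃ * θBal F.L γ (hF ▸ 𝔠).b₀ p₁ (K - k)) * (((F.L : ℝ) ^ (k - b))⁻¹) ^ 2) ≤ 1 / 2 then
                      (lieC (suGroupModel 2)).orthogonalProjectionOnto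
                        (vecE (suGroupModel 2).N
                          (B27T (unitsField (toUField (Averaging.iter (fun i => BlockAveraging.blockAvg (P := F.P K) (j := i) ℰp) b
                            ((p K).UkH k (Hist.triv (F.P K) k) W)))) (anchors_nonempty (F := F) K b Y).choose c))
                    else 0)
                  BR (canonLegDist F) (hF ▸ 𝔠).b₀ p₁ a C_B)) :
    K1aLegRowsDisplayChiAtLow L 𝔠 a₀ a₁ a p₁ := by
  obtain ⟨κ', ρ, C, C_A, C_B, γB, hκ', hρ, hC, hCA, hCB, hγB, hall⟩ := h
  have hB : 0 < 𝔠.B₃ := 𝔠.B₃_pos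
  have hδ : 0 < deltaSU (Fin 2) := deltaSU_pos
  have hp₁' : 0 < p₁ := by have := 𝔠.p₀_pos; have := 𝔠.one_le_r₀; linarith
  have hL7 : (0 : ℝ) < (((3 + 4) * L : ℕ) : ℝ) := by
    have h7 : 0 < (3 + 4) * L := by omega
    exact_mod_cast h7
  set σ : ℝ := min a₁ (min (a₀ / 𝔠.B₃) (min (1 / (3 * (143 * ((((3 + 4 : ℕ) : ℝ)) ^ 2 / 4) ^ 2) * 𝔠.B₃))
      (deltaSU (Fin 2) / ((((3 + 4) * L : ℕ) : ℝ) ^ 2 * 𝔠.B₃)))) with hσ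
  have hσpos : 0 < σ := by rw [hσ]; positivity
  refine ⟨κ', ρ, C, C_A, 24 * (L : ℝ) * 𝔠.B₃, C_B, min γB (gammaθ 𝔠.b₀ p₁ σ), hκ', hρ, hC, hCA, by positivity, hCB,
    lt_min hγB (gammaθ_pos 𝔠.b₀_pos hp₁' hσpos), fun F γ hF hγ hγle hγ1 => ?_⟩
  subst hF
  obtain ⟨Ψ, BR, hΨ, hBR, himp⟩ := hall F γ rfl hγ (hγle.trans (min_le_left _ _)) hγ1
  refine ⟨Ψ, BR, hΨ, hBR, fun hOf => ?_⟩
  obtain ⟨p, hp, Φ, e, hR1, hR2, hNΦe, hM1, hR5⟩ := himp hOf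
  have hθ : ∀ K n, n < K →
      θBal F.L γ 𝔠.b₀ p₁ n ≤ (p K).a₁ ∧ 𝔠.B₃ * θBal F.L γ 𝔠.b₀ p₁ n ≤ (p K).a₀ ∧
      (143 * ((((3 + 4 : ℕ) : ℝ)) ^ 2 / 4) ^ 2) * (𝔠.B₃ * θBal F.L γ 𝔠.b₀ p₁ n) ≤ 1 / 3 ∧
      2 * (𝔠.B₃ * θBal F.L γ 𝔠.b₀ p₁ n) ≤ 2 * deltaSU (Fin 2) / (((3 + 4) * F.L : ℕ) : ℝ) ^ 2 := fun K n _ => by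
    obtain ⟨h1, h2, h3, h4⟩ := windowLetters_of_le_gammaθ (𝔠 := 𝔠) hγ (hγ1.trans (sq_min_one_le _ 𝔠.gamma0_pos)) ha₀ ha₁ hp₁'
      (hγle.trans (min_le_right _ _)) n
    rw [(hp K).1, (hp K).2]
    exact ⟨h1, h2, h3, h4⟩
  refine ⟨p, hp, Φ, e,
    (fun K k b Y W c =>
        if h : b + 1 = k then birthCfgAt (fun K => (p K).toCore) K b Y (h ▸ W) c
        else if (l1 (rel (anchors_nonempty (F := F) K b Y).choose c.src) : ℝ) *
            (2 * (𝔠.B₃ * θBal F.L γ 𝔠.b₀ p₁ (K - k)) * (((F.L : ℝ) ^ (k - b))⁻¹) ^ 2) ≤ 1 / 2 then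
          (lieC (suGroupModel 2)).orthogonalProjectionOnto
            (vecE (suGroupModel 2).N
              (B27T (unitsField (toUField (Averaging.iter (fun i => BlockAveraging.blockAvg (P := F.P K) (j := i) ℰp) b
                ((p K).UkH k (Hist.triv (F.P K) k) W)))) (anchors_nonempty (F := F) K b Y).choose c))
        else 0), hR1, hR2, ?_, hM1, cfgDistOwnΦLow_chi_natural p hθ, hR5⟩
  intro K k hk X hX
  obtain ⟨hΦ, he⟩ := hNΦe K k hk X hX
  exact ⟨hΦ, he, fun W => natural_newLevel_eq_bcfg p K k hk X hX W⟩

end Summit.QuantumFields.YangMills.Theorems.GlobalSlackKernelLeg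

end
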